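import Literature.Computability.Complexity.GapCSP
import Literature.Computability.MetaComplexity.CMMSA
import HarnessLib

/-!
# Complexity core: the Dinur–Safra reduction from gap CSPs to CMMSA (Hirahara 2022, proof of Thm. 5.2), I

Support for the NP-hardness of the partial-function Minimum Circuit Size Problem `MCSP*`
(`Literature.Computability.Complexity.isRandNPHard_MCSPStar`; Hirahara, FOCS 2022, Thm. 1.2 =
Thm. 8.5 of ECCC TR22-119). Hirahara's Thm. 5.2 (NP-hardness of the gap problem `gapCMMSA`,
`MetaComplexity/CMMSA.lean`, the named fact `Hirahara2022_thm52_sqrtLog`) is proved in the paper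
by applying the Dinur–Safra reduction to the gap constraint satisfaction problem delivered by the
sliding-scale PCP (Lemma 5.3, the named fact `Hirahara2022_lem53_logPow_queried` of
`Complexity/GapCSPQueried.lean`, for the gap problem `gapCSP` of `Complexity/GapCSP.lean`).
This file formalises the **instance map** of that proof and its
elementary properties; the quantitative soundness analysis (Markov + random assignment +
averaging) is in the sibling file `CSPToCMMSASoundness.lean`.

The reduction (Hirahara 2022, proof of Thm. 5.2, p. 16): given a MaxCSP instance
`Ψ = {C₁, …, C_m}` over `n` variables with values in `Σ = [q]`, the CMMSA instance has one
variable (literal) `L_{x,a}` for every `(x, a) ∈ [n] × Σ` ("`x` is assigned `a`"), the monotone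
DNF formulas `φⱼ := ⋁_{r ∈ Cⱼ⁻¹(1)} ⋀_{x ∈ dom r} L_{x, r(x)}`, the weights
`w(x, a) := |Ψ(x)|` (the number of constraints containing the variable `x`), and the threshold
`s := m · D` (for constraints of arity exactly `D`; in general the total arity `Σⱼ |dom Cⱼ|`).

## Contents

* `CSPConstraint.toMonotoneDNF q C` — the DNF `φ_C` (literal `L_{x,a}` is the variable
  `x * q + a`); `CSPInstance.litWidth Ψ = max |Σ| 1`, `CSPInstance.occCount Ψ x = |Ψ(x)|`,
  `CSPInstance.totalArity`, `CSPInstance.toCMMSA Ψ` — the CMMSA instance `(Φ, w, s)`;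
* `CSPInstance.litAssign` — the assignment `L_{x,σ(x)} = 1` induced by a CSP assignment `σ`;
* `CSPInstance.litSet Ψ L x = A(x) = {a | L_{x,a} = 1}` and `litCard = |A(x)|`;
* proved: `toCMMSA_wellFormed`, `totalArity_eq_of_hasArity` (`s = m · D`),
  `numLiterals_toMonotoneDNF_le`, `length_accepting_le_pow` (`|C⁻¹(1)| ≤ |Σ|^D`),
  `degree_toCMMSA_le` and `degree_toCMMSA_le_pow` (degree `≤ D · maxⱼ |Cⱼ⁻¹(1)| ≤ D · |Σ|^D`),
  `weightOf_toCMMSA_eq` (the weight of any assignment is `Σ_x |Ψ(x)| · |A(x)|`, Eq. (4) of the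
  proof), and **completeness** `toCMMSA_complete`: a satisfying assignment of `Ψ` yields an
  assignment of weight `≤ s` satisfying every `φⱼ`.

## Design choices

* Literals are indexed `x * q₁ + a` with `q₁ = litWidth Ψ = max q 1`, so that the CMMSA size is
  `n · q₁ ≥ n` even for the degenerate alphabet `q = 0` (then no literal occurs and every `φⱼ` is
  the empty DNF).
* The threshold is the total arity `Σⱼ |dom Cⱼ|`, which is the printed `m · D` under
  `HasArity D` (`totalArity_eq_of_hasArity`) and makes completeness exact without the arity
  hypothesis.
* The conjunction `⋀_{x ∈ dom r} L_{x,r(x)}` is `List.zipWith (fun x a => x * q₁ + a) vars r`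
  (positional pairing of `dom Cⱼ` with the accepting local assignment `r`).
* Everything is stated for the structures `CSPInstance` (`Complexity/GapCSP.lean`) and
  `CMMSAInstance` (`MetaComplexity/CMMSA.lean`); the dot-notation extensions of
  `Literature.Computability.Complexity.CSPConstraint/CSPInstance` declared here are deliberate
  (absolute names, CONVENTIONS §2).

## References

* S. Hirahara, *NP-hardness of learning programs and partial MCSP*, FOCS 2022; ECCC TR22-119
  (numbering used here): Thm. 5.2 and its proof (pp. 16–18), Def. 5.1 (p. 15).
* I. Dinur, S. Safra, *On the hardness of approximating label-cover*, Inform. Process. Lett. 89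
  (2004), 247–254 (the original reduction to MMSA).
-/

namespace Literature.Computability.Complexity

open MetaComplexity

/-! ### The instance map -/

namespace CSPConstraint

/-- The monotone DNF `φ_C := ⋁_{r ∈ C⁻¹(1)} ⋀_{x ∈ dom r} L_{x, r(x)}` of a constraint `C`, the
literal `L_{x,a}` being the CMMSA variable `x * q + a` (Hirahara 2022, proof of Thm. 5.2, p. 16:
"For each `j ∈ [m]`, construct a monotone DNF formula `φⱼ` defined as …"). One term per accepting
local assignment `r`, pairing `dom C = vars` positionally with `r`. [cite: Hirahara2022PartialMCSP, proof of Thm. 5.2 (p. 16)] -/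
def toMonotoneDNF (q : ℕ) (C : CSPConstraint) : MonotoneDNF :=
  C.accepting.map fun r => List.zipWith (fun x a => x * q + a) C.vars r

/-- The terms of `φ_C` are the images of the accepting local assignments (definitional).
[cite: Hirahara2022PartialMCSP, proof of Thm. 5.2 (p. 16)] -/
theorem toMonotoneDNF_def (q : ℕ) (C : CSPConstraint) :
    C.toMonotoneDNF q = C.accepting.map fun r => List.zipWith (fun x a => x * q + a) C.vars r :=
  rfl

/-- `φ_C` is true under `a` iff some accepting local assignment `r` of `C` has all its literals
`L_{x, r(x)}`, `x ∈ dom C`, set to `1` (positional form). [cite: Hirahara2022PartialMCSP, proof of Thm. 5.2 (pp. 16–17)] -/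
theorem eval_toMonotoneDNF_eq_true_iff (q : ℕ) (C : CSPConstraint) (a : ℕ → Bool) :
    (C.toMonotoneDNF q).eval a = true ↔
      ∃ r ∈ C.accepting, ∀ (i : ℕ) (hi : i < C.vars.length) (hi' : i < r.length),
        a (C.vars[i] * q + r[i]) = true := by
  rw [toMonotoneDNF, MonotoneDNF.eval_eq_true_iff]
  constructor
  · rintro ⟨t, ht, hta⟩
    obtain ⟨r, hr, rfl⟩ := List.mem_map.1 ht
    refine ⟨r, hr, fun i hi hi' => hta _ ?_⟩
    rw [List.mem_iff_getElem]
    exact ⟨i, by simp [hi, hi'], by simp⟩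
  · rintro ⟨r, hr, hra⟩
    refine ⟨_, List.mem_map.2 ⟨r, hr, rfl⟩, fun l hl => ?_⟩
    obtain ⟨i, hi, rfl⟩ := List.mem_iff_getElem.1 hl
    simp only [List.length_zipWith, lt_min_iff] at hi
    simpa using hra i hi.1 hi.2

/-- The number of literals of `φ_C` is at most `|C⁻¹(1)| · |dom C|` (each term has
`min |dom C| |r| ≤ |dom C|` literals). [cite: Hirahara2022PartialMCSP, proof of Thm. 5.2 (p. 18, "The number of the literals in φⱼ")] -/
theorem numLiterals_toMonotoneDNF_le (q : ℕ) (C : CSPConstraint) :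
    (C.toMonotoneDNF q).numLiterals ≤ C.accepting.length * C.vars.length := by
  unfold toMonotoneDNF MonotoneDNF.numLiterals
  induction C.accepting with
  | nil => simp
  | cons r l ih =>
    simp only [List.map_cons, List.sum_cons, List.length_cons, List.length_zipWith]
    calc min C.vars.length r.length + (List.map List.length
            (List.map (fun r => List.zipWith (fun x a => x * q + a) C.vars r) l)).sum
        ≤ C.vars.length + l.length * C.vars.length := Nat.add_le_add (min_le_left _ _) ih
      _ = (l.length + 1) * C.vars.length := by ring

/-- Every literal of `φ_C` is `< n * q` when `C` is well formed over `n` variables and the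
alphabet `[q']` with `q' ≤ q` (literal `x * q + a` with `x < n`, `a < q`). [cite: Hirahara2022PartialMCSP, proof of Thm. 5.2 (p. 16)] -/
theorem isOver_toMonotoneDNF {n q q' : ℕ} {C : CSPConstraint} (hC : C.WellFormed n q')
    (hq : q' ≤ q) : (C.toMonotoneDNF q).IsOver (n * q) := by
  intro t ht l hl
  obtain ⟨r, hr, rfl⟩ := List.mem_map.1 ht
  obtain ⟨i, hi, rfl⟩ := List.mem_iff_getElem.1 hl
  simp only [List.length_zipWith, lt_min_iff] at hi
  rw [List.getElem_zipWith]
  have hx : C.vars[i] < n := hC.1 _ (List.getElem_mem hi.1)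
  have ha : r[i] < q := ((hC.2.2.2 r hr).2 _ (List.getElem_mem hi.2)).trans_le hq
  calc C.vars[i] * q + r[i] < C.vars[i] * q + q := Nat.add_lt_add_left ha _
    _ = (C.vars[i] + 1) * q := by ring
    _ ≤ n * q := Nat.mul_le_mul_right _ hx

/-- A well-formed constraint over the alphabet `[q]` has at most `q ^ |dom C|` accepting local
assignments (they are pairwise distinct words of length `|dom C|` over `[q]`; Hirahara:
"`|Cⱼ⁻¹(1)| · D ≤ |Σ|^D · D`"). [cite: Hirahara2022PartialMCSP, proof of Thm. 5.2 (p. 18)] -/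
theorem length_accepting_le_pow {n q : ℕ} {C : CSPConstraint} (hC : C.WellFormed n q) :
    C.accepting.length ≤ q ^ C.vars.length := by
  classical
  set D := C.vars.length
  let S : Finset (List ℕ) :=
    (Fintype.piFinset fun _ : Fin D => Finset.range q).image fun f => List.ofFn f
  have hsub : C.accepting.toFinset ⊆ S := by
    intro r hr
    rw [List.mem_toFinset] at hr
    obtain ⟨hlen, hval⟩ := hC.2.2.2 r hr
    refine Finset.mem_image.2 ⟨fun i => r[i.1]'(by rw [hlen]; exact i.2), ?_, ?_⟩
    · exact Fintype.mem_piFinset.2 fun i => Finset.mem_range.2 (hval _ (List.getElem_mem _))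
    · exact List.ext_getElem (by simp [hlen, D]) fun i h₁ h₂ => by simp
  calc C.accepting.length = C.accepting.toFinset.card := (List.toFinset_card_of_nodup hC.2.2.1).symm
    _ ≤ S.card := Finset.card_le_card hsub
    _ ≤ (Fintype.piFinset fun _ : Fin D => Finset.range q).card := Finset.card_image_le
    _ = q ^ D := by rw [Fintype.card_piFinset, Finset.prod_const, Finset.card_range, Finset.card_univ,
        Fintype.card_fin]

end CSPConstraint

namespace CSPInstance

/-- The literal width `q₁ := max |Σ| 1`: literals `L_{x,a}` are indexed `x * q₁ + a`, `a < q₁`.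
(For `|Σ| ≥ 1` this is `|Σ|`; the `max` only keeps the CMMSA size `n · q₁ ≥ n` when `Σ = ∅`.)
[cite: Hirahara2022PartialMCSP, proof of Thm. 5.2 (p. 16, "indexed by (x, a) ∈ [n] × Σ")] -/
def litWidth (Ψ : CSPInstance) : ℕ :=
  max Ψ.alphabetSize 1

/-- `|Ψ(x)|`: the number of constraints of `Ψ` containing `x` as a variable (the weight
`w(x, a)` of every literal `L_{x,a}`). [cite: Hirahara2022PartialMCSP, proof of Thm. 5.2 (p. 16, "w(x, a) … |Ψ(x)|")] -/
def occCount (Ψ : CSPInstance) (x : ℕ) : ℕ :=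
  Ψ.constraints.countP fun C => x ∈ C.vars

/-- The total arity `Σⱼ |dom Cⱼ|` of the instance (equal to `m · D` for arity exactly `D`,
`totalArity_eq_of_hasArity`); the threshold `s` of the reduction. [cite: Hirahara2022PartialMCSP, proof of Thm. 5.2 (p. 16, "s := mD")] -/
def totalArity (Ψ : CSPInstance) : ℕ :=
  (Ψ.constraints.map fun C => C.vars.length).sum

/-- **The Dinur–Safra / Hirahara instance map** `Ψ ↦ (Φ, w, s)` of the proof of Thm. 5.2:
`n · q₁` variables (the literals `L_{x,a} = x * q₁ + a`), the formulas `φⱼ = φ_{Cⱼ}`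
(`CSPConstraint.toMonotoneDNF`), the weights `w(x * q₁ + a) = |Ψ(x)|` (as a list of length
`n · q₁`, encoded in unary by `CMMSAInstance.encoding`), and the threshold `s = Σⱼ |dom Cⱼ|`
(`= m · D`). [cite: Hirahara2022PartialMCSP, proof of Thm. 5.2 (p. 16)] -/
def toCMMSA (Ψ : CSPInstance) : CMMSAInstance where
  numVars := Ψ.numVars * Ψ.litWidth
  formulas := Ψ.constraints.map fun C => C.toMonotoneDNF Ψ.litWidth
  weight := (List.range (Ψ.numVars * Ψ.litWidth)).map fun i => Ψ.occCount (i / Ψ.litWidth)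
  threshold := Ψ.totalArity

/-- The assignment of the literals induced by a CSP assignment `σ`: `L_{x,a} = 1` iff `x < n`,
`a < q₁` and `σ(x) = a` (proof of Thm. 5.2, completeness: "we set `L_{x,α(x)} := 1` and
`L_{x,y} := 0` for every `y ∈ Σ ∖ {α(x)}`"). [cite: Hirahara2022PartialMCSP, proof of Thm. 5.2 (p. 17)] -/
def litAssign (Ψ : CSPInstance) (σ : ℕ → ℕ) : ℕ → Bool :=
  fun i => decide (i < Ψ.numVars * Ψ.litWidth ∧ σ (i / Ψ.litWidth) = i % Ψ.litWidth)

/-! ### Basic identities -/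

/-- `1 ≤ q₁`. [folklore] -/
theorem one_le_litWidth (Ψ : CSPInstance) : 1 ≤ Ψ.litWidth :=
  le_max_right _ _

/-- `|Σ| ≤ q₁`. [folklore] -/
theorem alphabetSize_le_litWidth (Ψ : CSPInstance) : Ψ.alphabetSize ≤ Ψ.litWidth :=
  le_max_left _ _

/-- For a nonempty alphabet, `q₁ = |Σ|`. [folklore] -/
theorem litWidth_eq_of_pos {Ψ : CSPInstance} (h : 0 < Ψ.alphabetSize) : Ψ.litWidth = Ψ.alphabetSize :=
  max_eq_left h

/-- The number of CMMSA variables is `n · q₁` (definitional). [cite: Hirahara2022PartialMCSP, proof of Thm. 5.2 (p. 16)] -/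
@[simp] theorem toCMMSA_numVars (Ψ : CSPInstance) : Ψ.toCMMSA.numVars = Ψ.numVars * Ψ.litWidth :=
  rfl

/-- The CMMSA formulas are the `φ_{Cⱼ}` (definitional). [cite: Hirahara2022PartialMCSP, proof of Thm. 5.2 (p. 16)] -/
@[simp] theorem toCMMSA_formulas (Ψ : CSPInstance) :
    Ψ.toCMMSA.formulas = Ψ.constraints.map fun C => C.toMonotoneDNF Ψ.litWidth :=
  rfl

/-- The threshold is the total arity (definitional). [cite: Hirahara2022PartialMCSP, proof of Thm. 5.2 (p. 16)] -/
@[simp] theorem toCMMSA_threshold (Ψ : CSPInstance) : Ψ.toCMMSA.threshold = Ψ.totalArity :=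
  rfl

/-- The number of CMMSA formulas is the number `m` of constraints. [cite: Hirahara2022PartialMCSP, proof of Thm. 5.2 (p. 16)] -/
@[simp] theorem numFormulas_toCMMSA (Ψ : CSPInstance) :
    Ψ.toCMMSA.numFormulas = Ψ.numConstraints := by
  simp [CMMSAInstance.numFormulas, numConstraints]

/-- The weight of the literal `i < n · q₁` is `|Ψ(i / q₁)|`, i.e. `w(x * q₁ + a) = |Ψ(x)|`.
[cite: Hirahara2022PartialMCSP, proof of Thm. 5.2 (p. 16)] -/
theorem toCMMSA_w {Ψ : CSPInstance} {i : ℕ} (hi : i < Ψ.numVars * Ψ.litWidth) :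
    Ψ.toCMMSA.w i = Ψ.occCount (i / Ψ.litWidth) := by
  simp [CMMSAInstance.w, toCMMSA, List.getD_eq_getElem?_getD, List.getElem?_map,
    List.getElem?_range hi]

/-- Under arity exactly `D`, the threshold `Σⱼ |dom Cⱼ|` is the printed `s = m · D`.
[cite: Hirahara2022PartialMCSP, proof of Thm. 5.2 (p. 16, "s := mD")] -/
theorem totalArity_eq_of_hasArity {Ψ : CSPInstance} {D : ℕ} (hD : Ψ.HasArity D) :
    Ψ.totalArity = Ψ.numConstraints * D := by
  unfold totalArity numConstraints
  have key : ∀ l : List CSPConstraint, (∀ C ∈ l, C.vars.length = D) →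
      (l.map fun C => C.vars.length).sum = l.length * D := by
    intro l hl
    induction l with
    | nil => simp
    | cons C l ih =>
      simp only [List.map_cons, List.sum_cons, List.length_cons]
      rw [hl C (by simp), ih fun C' hC' => hl C' (by simp [hC'])]
      ring
  exact key _ hD

/-! ### Well-formedness and degree -/

/-- The CMMSA instance of a well-formed CSP instance is well formed (weights of length
`n · q₁`, literals `< n · q₁`). [cite: Hirahara2022PartialMCSP, proof of Thm. 5.2 (p. 16)] -/
theorem toCMMSA_wellFormed {Ψ : CSPInstance} (hwf : Ψ.WellFormed) : Ψ.toCMMSA.WellFormed := by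
  refine ⟨by simp [toCMMSA], fun φ hφ => ?_⟩
  obtain ⟨C, hC, rfl⟩ := List.mem_map.1 hφ
  exact CSPConstraint.isOver_toMonotoneDNF (hwf.2 C hC) Ψ.alphabetSize_le_litWidth

/-- **Degree bound.** If every constraint has arity `D` and at most `M` accepting local
assignments, the collection `Φ` has degree `≤ M · D` (Hirahara: "The number of the literals in
`φⱼ ∈ Φ` is at most `|Cⱼ⁻¹(1)| · D ≤ |Σ|^D · D`"). [cite: Hirahara2022PartialMCSP, proof of Thm. 5.2 (p. 18)] -/
theorem degree_toCMMSA_le {Ψ : CSPInstance} {D M : ℕ} (hD : Ψ.HasArity D)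
    (hM : ∀ C ∈ Ψ.constraints, C.accepting.length ≤ M) : Ψ.toCMMSA.degree ≤ M * D := by
  rw [CMMSAInstance.degree_le_iff]
  intro φ hφ
  obtain ⟨C, hC, rfl⟩ := List.mem_map.1 (by simpa using hφ)
  calc (C.toMonotoneDNF Ψ.litWidth).numLiterals ≤ C.accepting.length * C.vars.length :=
        CSPConstraint.numLiterals_toMonotoneDNF_le _ _
    _ ≤ M * D := by rw [hD C hC]; exact Nat.mul_le_mul_right _ (hM C hC)

/-- **Degree bound in terms of the alphabet**: a well-formed instance of arity `D` over `[q]`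
yields a collection of degree `≤ q^D · D` (Hirahara: "at most `|Cⱼ⁻¹(1)| · D ≤ |Σ|^D · D`").
[cite: Hirahara2022PartialMCSP, proof of Thm. 5.2 (p. 18)] -/
theorem degree_toCMMSA_le_pow {Ψ : CSPInstance} {D : ℕ} (hwf : Ψ.WellFormed) (hD : Ψ.HasArity D) :
    Ψ.toCMMSA.degree ≤ Ψ.alphabetSize ^ D * D :=
  degree_toCMMSA_le hD fun C hC => by
    simpa [hD C hC] using CSPConstraint.length_accepting_le_pow (hwf.2 C hC)


/-! ### The weight of an assignment (Eq. (4) of the proof) -/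

/-- The variable of the literal `L_{x,v} = x * q₁ + v`, `v < q₁`, is `x`. [cite: Hirahara2022PartialMCSP, proof of Thm. 5.2 (p. 16, literals indexed by [n] × Σ)] -/
theorem litIndex_div (Ψ : CSPInstance) {x v : ℕ} (hv : v < Ψ.litWidth) :
    (x * Ψ.litWidth + v) / Ψ.litWidth = x := by
  rw [Nat.add_comm, Nat.add_mul_div_right _ _ (lt_of_le_of_lt (Nat.zero_le _) hv),
    Nat.div_eq_of_lt hv, Nat.zero_add]

/-- The value of the literal `L_{x,v} = x * q₁ + v`, `v < q₁`, is `v`. [cite: Hirahara2022PartialMCSP, proof of Thm. 5.2 (p. 16, literals indexed by [n] × Σ)] -/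
theorem litIndex_mod (Ψ : CSPInstance) {x v : ℕ} (hv : v < Ψ.litWidth) :
    (x * Ψ.litWidth + v) % Ψ.litWidth = v :=
  Nat.mul_add_mod_of_lt hv


/-- `A(x) = {a < q₁ | L_{x,a} = 1}`: the values whose literal at `x` the assignment `a` sets to `1`
(proof of Thm. 5.2, p. 17: "let `A(x) := {a ∈ Σ | L_{x,a} = 1}`"). [cite: Hirahara2022PartialMCSP, proof of Thm. 5.2 (p. 17)] -/
def litSet (Ψ : CSPInstance) (a : ℕ → Bool) (x : ℕ) : Finset ℕ :=
  (Finset.range Ψ.litWidth).filter fun v => a (x * Ψ.litWidth + v) = true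

/-- `|A(x)|`. [cite: Hirahara2022PartialMCSP, proof of Thm. 5.2 (p. 17)] -/
def litCard (Ψ : CSPInstance) (a : ℕ → Bool) (x : ℕ) : ℕ :=
  (Ψ.litSet a x).card

/-- Membership in `A(x)`: `v ∈ A(x) ↔ v < q₁ ∧ L_{x,v} = 1`. [cite: Hirahara2022PartialMCSP, proof of Thm. 5.2 (p. 17)] -/
@[simp] theorem mem_litSet {Ψ : CSPInstance} {a : ℕ → Bool} {x v : ℕ} :
    v ∈ Ψ.litSet a x ↔ v < Ψ.litWidth ∧ a (x * Ψ.litWidth + v) = true := by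
  simp [litSet]

/-- `|A(x)| ≤ q₁`. [folklore] -/
theorem litCard_le_litWidth (Ψ : CSPInstance) (a : ℕ → Bool) (x : ℕ) : Ψ.litCard a x ≤ Ψ.litWidth := by
  unfold litCard litSet
  exact (Finset.card_filter_le _ _).trans (Finset.card_range _).le

/-- Block decomposition of a sum over `range (n * q)` along `i = x * q + v`. [folklore] -/
theorem sum_range_mul_eq_sum_sum (f : ℕ → ℕ) (n q : ℕ) :
    ∑ i ∈ Finset.range (n * q), f i = ∑ x ∈ Finset.range n, ∑ v ∈ Finset.range q, f (x * q + v) := by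
  induction n with
  | zero => simp
  | succ n ih => rw [Nat.succ_mul, Finset.sum_range_add, ih, Finset.sum_range_succ]

/-- **Eq. (4) of the proof of Thm. 5.2**: the weight of any assignment of the literals is
`w(L) = Σ_{x < n} |Ψ(x)| · |A(x)|`. [cite: Hirahara2022PartialMCSP, proof of Thm. 5.2 (p. 17, Eq. (4))] -/
theorem weightOf_toCMMSA_eq (Ψ : CSPInstance) (a : ℕ → Bool) :
    Ψ.toCMMSA.weightOf a = ∑ x ∈ Finset.range Ψ.numVars, Ψ.occCount x * Ψ.litCard a x := by
  unfold CMMSAInstance.weightOf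
  rw [toCMMSA_numVars]
  have h1 : ∀ i ∈ Finset.range (Ψ.numVars * Ψ.litWidth),
      (if a i = true then Ψ.toCMMSA.w i else 0) =
        if a i = true then Ψ.occCount (i / Ψ.litWidth) else 0 := by
    intro i hi
    rw [toCMMSA_w (Finset.mem_range.1 hi)]
  rw [Finset.sum_congr rfl h1, sum_range_mul_eq_sum_sum]
  refine Finset.sum_congr rfl fun x _ => ?_
  have h2 : ∀ v ∈ Finset.range Ψ.litWidth,
      (if a (x * Ψ.litWidth + v) = true then Ψ.occCount ((x * Ψ.litWidth + v) / Ψ.litWidth) else 0)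
        = if a (x * Ψ.litWidth + v) = true then Ψ.occCount x else 0 := by
    intro v hv
    rw [Ψ.litIndex_div (Finset.mem_range.1 hv)]
  rw [Finset.sum_congr rfl h2, ← Finset.sum_filter, Finset.sum_const, smul_eq_mul, mul_comm]
  rfl

/-- `Σ_{x < n} |Ψ(x)| ≤ Σⱼ |dom Cⱼ|` (each constraint is counted once for each of its distinct
variables below `n`). [cite: Hirahara2022PartialMCSP, proof of Thm. 5.2 (p. 17, "w(L) = Σ_x |Ψ(x)| = … = mD")] -/
theorem sum_occCount_le_totalArity (Ψ : CSPInstance) :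
    ∑ x ∈ Finset.range Ψ.numVars, Ψ.occCount x ≤ Ψ.totalArity := by
  unfold occCount totalArity
  induction Ψ.constraints with
  | nil => simp
  | cons C l ih =>
    simp only [List.countP_cons, List.map_cons, List.sum_cons, Finset.sum_add_distrib]
    rw [add_comm]
    refine Nat.add_le_add ?_ ih
    calc ∑ x ∈ Finset.range Ψ.numVars, (if decide (x ∈ C.vars) = true then 1 else 0)
        = ((Finset.range Ψ.numVars).filter fun x => x ∈ C.vars).card := by
          rw [Finset.card_filter]; simp
      _ ≤ C.vars.toFinset.card :=
          Finset.card_le_card fun x hx => by simpa using (Finset.mem_filter.1 hx).2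
      _ ≤ C.vars.length := List.toFinset_card_le _

/-! ### Completeness -/

/-- The induced assignment sets at most one literal per variable: `|A(x)| ≤ 1`.
[cite: Hirahara2022PartialMCSP, proof of Thm. 5.2 (p. 17, completeness)] -/
theorem litCard_litAssign_le_one (Ψ : CSPInstance) (σ : ℕ → ℕ) (x : ℕ) :
    Ψ.litCard (Ψ.litAssign σ) x ≤ 1 := by
  unfold litCard
  refine Finset.card_le_one.2 fun v hv v' hv' => ?_
  simp only [mem_litSet, litAssign, decide_eq_true_eq] at hv hv'
  have h1 := hv.2.2
  have h2 := hv'.2.2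
  rw [Ψ.litIndex_div hv.1, Ψ.litIndex_mod hv.1] at h1
  rw [Ψ.litIndex_div hv'.1, Ψ.litIndex_mod hv'.1] at h2
  exact h1.symm.trans h2

/-- The induced assignment has weight `≤ Σ_x |Ψ(x)| ≤ s`. [cite: Hirahara2022PartialMCSP, proof of Thm. 5.2 (p. 17, "w(L) = … = mD")] -/
theorem weightOf_litAssign_le (Ψ : CSPInstance) (σ : ℕ → ℕ) :
    Ψ.toCMMSA.weightOf (Ψ.litAssign σ) ≤ Ψ.toCMMSA.threshold := by
  rw [weightOf_toCMMSA_eq, toCMMSA_threshold]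
  refine le_trans (Finset.sum_le_sum fun x _ => ?_) Ψ.sum_occCount_le_totalArity
  simpa using Nat.mul_le_mul_left (Ψ.occCount x) (Ψ.litCard_litAssign_le_one σ x)

/-- The induced assignment of a satisfying CSP assignment satisfies every `φⱼ` (the term of the
accepting local assignment `r = α|_{dom Cⱼ}` has all its literals `L_{x,α(x)}` set).
[cite: Hirahara2022PartialMCSP, proof of Thm. 5.2 (p. 17, "C_j(α) = 1; thus φⱼ(L) = 1")] -/
theorem eval_toMonotoneDNF_litAssign {Ψ : CSPInstance} (hwf : Ψ.WellFormed) {σ : ℕ → ℕ}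
    {C : CSPConstraint} (hC : C ∈ Ψ.constraints) (hσ : C.IsSatisfiedBy σ = true) :
    (C.toMonotoneDNF Ψ.litWidth).eval (Ψ.litAssign σ) = true := by
  rw [CSPConstraint.eval_toMonotoneDNF_eq_true_iff]
  rw [CSPConstraint.isSatisfiedBy_eq_true_iff] at hσ
  refine ⟨C.vars.map σ, hσ, fun i hi hi' => ?_⟩
  have hwC := hwf.2 C hC
  have hx : C.vars[i] < Ψ.numVars := hwC.1 _ (List.getElem_mem hi)
  have hv : (C.vars.map σ)[i] < Ψ.litWidth :=
    ((hwC.2.2.2 _ hσ).2 _ (List.getElem_mem hi')).trans_le Ψ.alphabetSize_le_litWidth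
  simp only [litAssign, decide_eq_true_eq]
  refine ⟨?_, ?_⟩
  · calc C.vars[i] * Ψ.litWidth + (C.vars.map σ)[i] < C.vars[i] * Ψ.litWidth + Ψ.litWidth :=
          Nat.add_lt_add_left hv _
      _ = (C.vars[i] + 1) * Ψ.litWidth := by ring
      _ ≤ Ψ.numVars * Ψ.litWidth := Nat.mul_le_mul_right _ hx
  · rw [Ψ.litIndex_div hv, Ψ.litIndex_mod hv]
    simp

/-- **Completeness of the reduction** (Hirahara 2022, proof of Thm. 5.2, first paragraph of
p. 17): if the CSP instance `Ψ` is satisfiable then the CMMSA instance `(Φ, w, s)` admits an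
assignment of weight `≤ s` satisfying every formula of `Φ` — namely `L_{x,α(x)} = 1` for a
satisfying assignment `α`. [cite: Hirahara2022PartialMCSP, proof of Thm. 5.2 (p. 17, completeness)] -/
theorem toCMMSA_complete {Ψ : CSPInstance} (hwf : Ψ.WellFormed) (hsat : Ψ.IsSatisfiable) :
    ∃ a : ℕ → Bool, Ψ.toCMMSA.weightOf a ≤ Ψ.toCMMSA.threshold ∧
      ∀ φ ∈ Ψ.toCMMSA.formulas, φ.eval a = true := by
  obtain ⟨σ, hσ⟩ := hsat
  refine ⟨Ψ.litAssign σ, Ψ.weightOf_litAssign_le σ, fun φ hφ => ?_⟩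
  obtain ⟨C, hC, rfl⟩ := List.mem_map.1 (by simpa using hφ)
  exact eval_toMonotoneDNF_litAssign hwf hC (hσ C hC)

end CSPInstance

end Literature.Computability.Complexity
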